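import Summits.BirchSwinnertonDyer.Rank1Residual.X11b.UnramifiedPrimaryVanishing
import Summits.BirchSwinnertonDyer.Rank1Residual.Iwasawa.LocalTowerKernelCardLeTorsion
import Literature.NumberTheory.EllipticCurves.GeomPointsGaloisModule
import HarnessLib

/-!
# `res : H¹(D, M) → H¹(I, M)` is injective when `φ − 1` is onto the inertia INVARIANTS `M^I`;
# the `D_v`-fixed points of `E[p^∞]` are finite (team n1011, row T-GP6, seat p10 GEN 11, FILE 1a — TOOL)

HONEST FRAMING (cell `b2b-bsdres-*`, team n1011, verbatim): prove what is provable now; shrink each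
hard class to its core with data; no claim beyond stated classes. Research route; TOOL theorems
only — no definition, no named fact, nothing booked, no residual-map mark moved, no class closed.

## What

Row T-GP6 discharges the named fact `GrossParson2011.lemma6_kummerSelmerStructure_eq_unramifiedSubgroup`
(Gross–Parson 2012, Lemma 6, case `R₀ = ℤ`: at a finite place `v ∤ p` with `p ∤ #Φ_v(k̄)` the local
Kummer condition of `E[p]` IS `H¹_ur(K_v, E[p])`).  The tree has the GOOD case, resting on "the
inertia group acts TRIVIALLY on `E[p^∞]`" (Silverman VII.4.1): `AcSelmer.resOfLe_injective_of_frobenius_generation`,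
`LocBridge.unramifiedSubgroup_primary_eq_bot`, `AcSelmer.ker_map_primaryInclusion_restrictField_eq_unramifiedSubgroup`,
`KummerPT.kummerSelmerStructure_inr_eq_unramifiedSubgroup`.  The row re-proves them under the ONE
hypothesis that replaces good reduction in Gross–Parson's lemma — (DIV): `E[p^∞]^{I_v}` is
`p`-divisible.  This file holds the two inputs that do not mention (DIV):

* §1 `resOfLe_injective_of_frobenius_generation_of_invariants` — the tree's generic lemma
  (`res : H¹(D, M) → H¹(I, M)` injective from "`D = ⟨φ⟩·I·U` for every open `U`") with its hypothesis
  "`I` acts trivially on `M` and `φ − 1` is onto `M`" WEAKENED to "`I` is normalised by `D` and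
  `φ − 1` is onto `M^I`": a cocycle on `D` dying on `I` is cohomologous to one VANISHING on `I`; such
  a cocycle takes values in `M^I`; kill `ψ(φ)` inside `M^I`; conclude by the open zero set and Frobenius
  generation exactly as the tree (`ker res = H¹(D/I, M^I) = M^I/(φ−1)M^I`, Milne *ADT* I §2;
  Serre *CG* I §2.6 (b)).
* §2 at the chosen prime `𝔓₀ ∣ v` of an elliptic curve: `I_{𝔓₀}` is normalised by `D_{𝔓₀}`
  (`inv_mul_mul_mem_inertia_adicCompletionPrime`); `I_{𝔓₀}`-fixed = fixed by `absInertia K_v` through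
  `res` (`forall_inertia_adicCompletionPrime_smul_eq_iff`); a point of `E[p^∞]` fixed by `I_{𝔓₀}` and
  by a Frobenius is fixed by `D_{𝔓₀}` (`smul_eq_of_mem_decompositionSubgroup_of_inertia_of_frob`); and
  at `v ∤ p` **the `D_{𝔓₀}`-fixed points of `E[p^∞]` form a finite set**
  (`finite_setOf_forall_decompositionSubgroup_smul_eq`: along the chosen embedding they inject into
  `E(K_v)[p^∞]`, finite by `Iwasawa.finite_fixedTorsion_localPoints`; Greenberg LNM 1716 p. 87:
  "the kernel of `γ_v − 1` acting on `B_v` is `E(F_v)_{p^∞}`, which is finite").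

FILE 1b (`UnramifiedPrimaryVanishingOfDivisible`) turns these into `φ − 1` onto `E[p^∞]^{I_v}`,
`H¹(D_v, E[p^∞]) ↪ H¹(I_v, E[p^∞])` and `H¹_ur(K_v, E[p^∞]) = 0` under (DIV).

References: [GrossParson2011] Lemma 6 (p. 226); [MilneADT2006] I §2; [GreenbergLNM1716] §3
Lemma 3.3 (pp. 86–88); [SerreGaloisCohomology1997] I §2.6 (b), I §5; [NeukirchANT1999] I §9 (9.4),
II §9 (9.6); [SilvermanAEC2009] VII.4.1, III.6.4.
-/

noncomputable section

open scoped Classical Topology Pointwise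

open NumberField IsDedekindDomain Field
open Literature.NumberTheory.EllipticCurves Literature.NumberTheory.EllipticCurves.GreenbergSelmer
open Literature.NumberTheory.GaloisRepresentations IsDedekindDomain.HeightOneSpectrum
open Literature.NumberTheory.GaloisRepresentations.IsNonarchimedeanLocalField

universe u

namespace Summit.BirchSwinnertonDyer.Rank1Residual.GaloisImage.InertiaDivisible

open Summit.BirchSwinnertonDyer.Rank1Residual.X11b.AcSelmer
open Summit.BirchSwinnertonDyer.Rank1Residual.X11b.LocBridge

/-! ## §1. Generic: `res : H¹(D, M) → H¹(I, M)` injective when `φ − 1` is onto `M^I` -/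

section Generic

variable {K : Type u} [Field K]
variable {M : Type u} [AddCommGroup M] [DistribMulAction (absoluteGaloisGroup K) M]
  [TopologicalSpace M] [DiscreteTopology M]

/-- **Injectivity of `res : H¹(D, M) → H¹(I, M)` from Frobenius generation, with NON-trivial
inertia action.** Let `I ≤ D ≤ Γ_K` with `I` normalised by `D`, `φ ∈ D`, and suppose every `d ∈ D` is
`φⁿ·i·u` with `i ∈ I`, `u ∈ U` for EVERY open subgroup `U ≤ Γ_K`; let `M` be a discrete `Γ_K`-module
with continuous orbit maps such that `φ − 1` maps the `I`-invariants `M^I` ONTO `M^I`. Then a class of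
`H¹(D, M)` restricting to `0` on `I` is `0`: its cocycle `ψ` is principal on `I`, `ψ = ∂v` there;
`ψ − ∂v` vanishes on `I` and therefore takes values in `M^I` and is constant on `I`-cosets (cocycle
identity, `I` normal in `D`); with `b ∈ M^I`, `φ b − b = (ψ − ∂v)(φ)`, the cocycle `ψ − ∂v − ∂b` vanishes
at `φ`, on `I`, on `⟨φ⟩·I`, and on `D ∩ U` for the open subgroup `U` inside its open zero set
(`krullTopology_mem_nhds_one_iff`), hence everywhere.  This is the tree's
`AcSelmer.resOfLe_injective_of_frobenius_generation` (Serre *CG* I §2.6 (b); "`ker res = H¹(D/I, M^I)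
= M^I/(φ−1)M^I`") with `M` replaced by `M^I` in the surjectivity hypothesis.
[cite: SerreGaloisCohomology1997, I.§2.6 (b) and I.§5.1] [cite: MilneADT2006, Ch. I §2 (unramified cohomology)] -/
theorem resOfLe_injective_of_frobenius_generation_of_invariants {I D : Subgroup (absoluteGaloisGroup K)}
    (hID : I ≤ D) (hnorm : ∀ d ∈ D, ∀ i ∈ I, d⁻¹ * i * d ∈ I) {φ : absoluteGaloisGroup K} (hφD : φ ∈ D)
    (hgen : ∀ U : Subgroup (absoluteGaloisGroup K), IsOpen (U : Set (absoluteGaloisGroup K)) →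
      ∀ d ∈ D, ∃ (n : ℕ) (i u : absoluteGaloisGroup K), i ∈ I ∧ u ∈ U ∧ d = φ ^ n * i * u)
    (hcont : ∀ m : M, Continuous fun g : absoluteGaloisGroup K ↦ g • m)
    (hsurj : ∀ m : M, (∀ i ∈ I, i • m = m) → ∃ b : M, (∀ i ∈ I, i • b = b) ∧ φ • b - b = m) :
    Function.Injective (resOfLe M hID) := by
  rw [injective_iff_map_eq_zero]
  intro c hc
  obtain ⟨ψ, rfl⟩ := oneCocycleClass_surjective _ c
  -- the restricted class is the class of the pulled-back cocycle; it is a coboundary `∂v` on `I`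
  have hres : resOfLe M hID (oneCocycleClass _ ψ) = oneCocycleClass _
      (contOneCocycles.pullback (subgroupInclusion hID)
        (resHomOfEquivariant (subgroupInclusion hID) (AddMonoidHom.id M) (fun _ _ ↦ rfl)) ψ) :=
    map_oneCocycleClass _ _ _ ψ
  rw [hres, oneCocycleClass_eq_zero_iff] at hc
  obtain ⟨v, hv⟩ := hc
  have hψI : ∀ (i : absoluteGaloisGroup K) (hi : i ∈ I), ψ.1 ⟨i, hID hi⟩ = i • v - v := by
    intro i hi
    have key := hv ⟨i, hi⟩
    rw [contOneCocycles.pullback_apply] at key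
    change ψ.1 (subgroupInclusion hID ⟨i, hi⟩) = (⟨i, hi⟩ : I) • v - v at key
    have e : subgroupInclusion hID ⟨i, hi⟩ = ⟨i, hID hi⟩ := Subtype.ext rfl
    rw [e] at key
    exact key
  -- first adjustment: `ψ₁ = ψ − ∂v` vanishes on `I`
  have hcontv : Continuous fun g : D ↦ g • v := (hcont v).comp continuous_subtype_val
  set ψ₁ := ψ - cobCocycle v hcontv with hψ₁
  have hψ₁I : ∀ (i : absoluteGaloisGroup K) (hi : i ∈ I), ψ₁.1 ⟨i, hID hi⟩ = 0 := by
    intro i hi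
    rw [hψ₁, Submodule.coe_sub, ContinuousMap.sub_apply, cobCocycle_apply, hψI i hi]
    change i • v - v - (i • v - v) = 0
    rw [sub_self]
  -- cocycle identity for `ψ₁`
  have hmul₁ : ∀ x y : D, ψ₁.1 (x * y) = ψ₁.1 x + (x : absoluteGaloisGroup K) • ψ₁.1 y :=
    fun x y ↦ ψ₁.2 x y
  -- `ψ₁` takes values in `M^I` (cocycle identity + `I` normalised by `D`)
  have hval₁ : ∀ (d : D) (i : absoluteGaloisGroup K), i ∈ I → i • ψ₁.1 d = ψ₁.1 d := by
    intro d i hi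
    have hi' : (d : absoluteGaloisGroup K)⁻¹ * i * d ∈ I := hnorm d d.2 i hi
    have e : (⟨i, hID hi⟩ : D) * d = d * ⟨(d : absoluteGaloisGroup K)⁻¹ * i * d, hID hi'⟩ :=
      Subtype.ext (by simp only [Subgroup.coe_mul]; group)
    have h1 := hmul₁ ⟨i, hID hi⟩ d
    rw [hψ₁I i hi, zero_add] at h1
    have h2 := hmul₁ d ⟨(d : absoluteGaloisGroup K)⁻¹ * i * d, hID hi'⟩
    rw [hψ₁I _ hi', smul_zero, add_zero] at h2
    rw [e, h2] at h1
    exact h1.symm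
  -- second adjustment: `b ∈ M^I` with `φ b − b = ψ₁(φ)`; `ψ₂ = ψ₁ − ∂b` vanishes at `φ` and on `I`
  obtain ⟨b, hbI, hb⟩ := hsurj (ψ₁.1 ⟨φ, hφD⟩) (fun i hi ↦ hval₁ ⟨φ, hφD⟩ i hi)
  have hcontb : Continuous fun g : D ↦ g • b := (hcont b).comp continuous_subtype_val
  set ψ₂ := ψ₁ - cobCocycle b hcontb with hψ₂
  have hψ₂φ : ψ₂.1 ⟨φ, hφD⟩ = 0 := by
    rw [hψ₂, Submodule.coe_sub, ContinuousMap.sub_apply, cobCocycle_apply]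
    change ψ₁.1 ⟨φ, hφD⟩ - (φ • b - b) = 0
    rw [hb, sub_self]
  have hψ₂I : ∀ (i : absoluteGaloisGroup K) (hi : i ∈ I), ψ₂.1 ⟨i, hID hi⟩ = 0 := by
    intro i hi
    rw [hψ₂, Submodule.coe_sub, ContinuousMap.sub_apply, cobCocycle_apply, hψ₁I i hi]
    change (0 : M) - (i • b - b) = 0
    rw [hbI i hi, sub_self, sub_zero]
  have hmul : ∀ x y : D, ψ₂.1 (x * y) = ψ₂.1 x + (x : absoluteGaloisGroup K) • ψ₂.1 y :=
    fun x y ↦ ψ₂.2 x y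
  have hpow : ∀ n : ℕ, ψ₂.1 (⟨φ, hφD⟩ ^ n) = 0 := by
    intro n
    induction n with
    | zero => rw [pow_zero]; exact contOneCocycles.apply_one ψ₂
    | succ n ih => rw [pow_succ, hmul, ih, hψ₂φ, smul_zero, add_zero]
  -- the zero set of `ψ₂` is open in `D`; it contains `D ∩ U` for an open subgroup `U ≤ Γ_K`
  have hopen : IsOpen ((fun x : D ↦ ψ₂.1 x) ⁻¹' {0}) :=
    (isOpen_discrete ({0} : Set M)).preimage ψ₂.1.continuous
  obtain ⟨V, hV, hVeq⟩ := isOpen_induced_iff.mp hopen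
  have h1V : (1 : absoluteGaloisGroup K) ∈ V := by
    have h1 : (1 : D) ∈ (fun x : D ↦ ψ₂.1 x) ⁻¹' {0} := contOneCocycles.apply_one ψ₂
    rw [← hVeq] at h1
    exact h1
  obtain ⟨F, hFfin, hFV⟩ :=
    (krullTopology_mem_nhds_one_iff K (AlgebraicClosure K) V).mp (hV.mem_nhds h1V)
  haveI := hFfin
  have hU0 : ∀ (w : absoluteGaloisGroup K) (hw : w ∈ F.fixingSubgroup) (hwD : w ∈ D),
      ψ₂.1 ⟨w, hwD⟩ = 0 := by
    intro w hw hwD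
    have h : (⟨w, hwD⟩ : D) ∈ Subtype.val ⁻¹' V := hFV hw
    rw [hVeq] at h
    exact h
  -- `ψ₂ = 0`
  have hψ₂0 : ψ₂ = 0 := by
    apply Subtype.ext
    ext d
    obtain ⟨n, i, w, hi, hw, hd⟩ :=
      hgen F.fixingSubgroup (IntermediateField.fixingSubgroup_isOpen F) d d.2
    have hwD : w ∈ D := by
      have e : w = (φ ^ n * i)⁻¹ * d := by rw [hd, inv_mul_cancel_left]
      rw [e]
      exact D.mul_mem (D.inv_mem (D.mul_mem (D.pow_mem hφD n) (hID hi))) d.2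
    have e : d = ⟨φ, hφD⟩ ^ n * ⟨i, hID hi⟩ * ⟨w, hwD⟩ :=
      Subtype.ext (by simp only [Subgroup.coe_mul, SubgroupClass.coe_pow]; exact hd)
    rw [e, hmul, hmul, hpow n, hψ₂I i hi, hU0 w hw hwD]
    simp only [smul_zero, add_zero]
    rfl
  -- classes: `[ψ] = [ψ₁] = [ψ₂] = 0`
  have hcls₁ : oneCocycleClass _ ψ₁ = oneCocycleClass _ ψ := by
    rw [hψ₁, oneCocycleClass_sub, oneCocycleClass_cobCocycle, sub_zero]
  have hcls₂ : oneCocycleClass _ ψ₂ = oneCocycleClass _ ψ₁ := by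
    rw [hψ₂, oneCocycleClass_sub, oneCocycleClass_cobCocycle, sub_zero]
  rw [← hcls₁, ← hcls₂, hψ₂0, oneCocycleClass_zero]

end Generic

/-! ## §2. The chosen prime `𝔓₀ ∣ v` of an elliptic curve: normality, the two inertia spellings, finiteness of `E[p^∞]^{D_v}` -/

section Curve

variable {K : Type} [Field K] [NumberField K] (E : WeierstrassCurve K) [E.IsElliptic]
  (p : ℕ) [Fact p.Prime]

/-- The inertia group `I_{𝔓₀}` of the chosen prime `𝔓₀ ∣ v` is normalised by its decomposition
group (Mathlib: `(𝔓.inertia (stabilizer)).Normal`). [folklore] -/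
theorem inv_mul_mul_mem_inertia_adicCompletionPrime (v : HeightOneSpectrum (𝓞 K))
    {d : absoluteGaloisGroup K}
    (hd : d ∈ (adicCompletionPrime K v).decompositionSubgroup (absoluteGaloisGroup K))
    {i : absoluteGaloisGroup K} (hi : i ∈ (adicCompletionPrime K v).inertia (absoluteGaloisGroup K)) :
    d⁻¹ * i * d ∈ (adicCompletionPrime K v).inertia (absoluteGaloisGroup K) := by
  rw [AddSubgroup.mem_inertia] at hi ⊢
  intro x
  have hd' := (Ideal.mem_decompositionSubgroup_iff).mp (Subgroup.inv_mem _ hd)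
  have h2 : d⁻¹ • (i • (d • x) - d • x) ∈ d⁻¹ • adicCompletionPrime K v :=
    Ideal.smul_mem_pointwise_smul d⁻¹ _ (adicCompletionPrime K v) (hi (d • x))
  rw [hd'] at h2
  have e : (d⁻¹ * i * d) • x - x = d⁻¹ • (i • (d • x) - d • x) := by
    rw [smul_sub, mul_smul, mul_smul, inv_smul_smul]
  rw [Submodule.mem_toAddSubgroup, e]
  exact h2

omit [E.IsElliptic] [Fact p.Prime] in
/-- Fixed by `I_{𝔓₀}` iff fixed by the local inertia group `absInertia K_v` acting through
`res : Γ_{K_v} → Γ_K` (`I_{𝔓₀} = res (I_{K_v})`, `inertia_adicCompletionPrime_eq_map_absInertia`).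
[cite: NeukirchANT1999, Ch. II §9 Prop. (9.6)] -/
theorem forall_inertia_adicCompletionPrime_smul_eq_iff (v : HeightOneSpectrum (𝓞 K))
    (t : E.geomPrimaryTorsion p) :
    (∀ i ∈ (adicCompletionPrime K v).inertia (absoluteGaloisGroup K), i • t = t) ↔
      ∀ τ ∈ absInertia (v.adicCompletion K), absGaloisRestrict K (v.adicCompletion K) τ • t = t := by
  rw [inertia_adicCompletionPrime_eq_map_absInertia]
  constructor
  · intro h τ hτ
    exact h _ (Subgroup.mem_map.mpr ⟨τ, hτ, rfl⟩)
  · intro h i hi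
    obtain ⟨τ, hτ, rfl⟩ := Subgroup.mem_map.mp hi
    exact h τ hτ

omit [E.IsElliptic] [Fact p.Prime] in
/-- A point of `E[p^∞]` fixed by `I_{𝔓₀}` and by an arithmetic Frobenius `φ` at `𝔓₀` is fixed by
the whole decomposition group `D_{𝔓₀}` (`D_{𝔓₀} = ⟨φ⟩·I·U` for the open stabiliser `U` of the
point, `exists_eq_frobenius_pow_mul_of_mem_decompositionSubgroup`).
[cite: NeukirchANT1999, I §9 Prop. (9.4)] -/
theorem smul_eq_of_mem_decompositionSubgroup_of_inertia_of_frob (v : HeightOneSpectrum (𝓞 K))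
    {φ : absoluteGaloisGroup K} (hφ : IsArithFrobAt (𝓞 K) φ (adicCompletionPrime K v))
    {t : E.geomPrimaryTorsion p}
    (hI : ∀ i ∈ (adicCompletionPrime K v).inertia (absoluteGaloisGroup K), i • t = t)
    (hφt : φ • t = t) {d : absoluteGaloisGroup K}
    (hd : d ∈ (adicCompletionPrime K v).decompositionSubgroup (absoluteGaloisGroup K)) :
    d • t = t := by
  have hU : IsOpen ((MulAction.stabilizer (absoluteGaloisGroup K) t : Subgroup (absoluteGaloisGroup K)) :
      Set (absoluteGaloisGroup K)) := isOpen_stabilizer_geomPrimaryTorsion E p t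
  obtain ⟨n, i, u, hi, hu, rfl⟩ := exists_eq_frobenius_pow_mul_of_mem_decompositionSubgroup
    (adicCompletionPrime_mem_primesAbove K v) hφ hU hd
  have hφn : ∀ n : ℕ, φ ^ n • t = t := by
    intro n
    induction n with
    | zero => rw [pow_zero, one_smul]
    | succ n ih => rw [pow_succ, mul_smul, hφt, ih]
  rw [mul_smul, mul_smul, MulAction.mem_stabilizer_iff.mp hu, hI i hi, hφn]

omit [Fact p.Prime] in
/-- The `D_{𝔓₀}`-fixed points of `E[p^∞]` form a finite set: `D_{𝔓₀} = res Γ_{K_v}`, so along the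
chosen embedding `K̄ → K̄_v` they inject into the `Γ_{K_v}`-fixed `p`-power torsion of `E(K̄_v)`,
i.e. `E(K_v)[p^∞]`, which is finite (`Iwasawa.finite_fixedTorsion_localPoints`). Greenberg, LNM 1716,
p. 87 ("the kernel of `γ_v − 1` acting on `B_v` is `E(F_v)_{p^∞}`, which is finite").
[cite: GreenbergLNM1716, §3 Lemma 3.3 (proof, p. 87)] -/
theorem finite_setOf_forall_decompositionSubgroup_smul_eq {v : HeightOneSpectrum (𝓞 K)}
    (hpv : (p : 𝓞 K) ∉ v.asIdeal) :
    Set.Finite {t : E.geomPrimaryTorsion p |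
      ∀ d ∈ (adicCompletionPrime K v).decompositionSubgroup (absoluteGaloisGroup K), d • t = t} := by
  haveI := Iwasawa.finite_fixedTorsion_localPoints E (p := p) hpv
  let F : {t : E.geomPrimaryTorsion p |
      ∀ d ∈ (adicCompletionPrime K v).decompositionSubgroup (absoluteGaloisGroup K), d • t = t} →
      {P : localPoints E (v.adicCompletion K) //
        (∀ σ : Field.absoluteGaloisGroup (v.adicCompletion K), σ • P = P) ∧ ∃ k : ℕ, p ^ k • P = 0} :=
    fun t ↦ ⟨pointsMap E (v.adicCompletion K) ((t : E.geomPrimaryTorsion p) : E.geomPoints), by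
      refine ⟨fun σ ↦ ?_, ?_⟩
      · have hσ : absGaloisRestrict K (v.adicCompletion K) σ ∈
            (adicCompletionPrime K v).decompositionSubgroup (absoluteGaloisGroup K) := by
          rw [decompositionSubgroup_adicCompletionPrime_eq_range]; exact ⟨σ, rfl⟩
        have h := t.2 _ hσ
        rw [← pointsMap_smul, WeierstrassCurve.resGal_eq_absGaloisRestrict]
        exact congrArg (fun z : E.geomPrimaryTorsion p ↦
          pointsMap E (v.adicCompletion K) (z : E.geomPoints)) h
      · obtain ⟨k, hk⟩ := (AddCommGroup.mem_primaryComponent).mp (t : E.geomPrimaryTorsion p).2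
        exact ⟨k, by rw [← map_nsmul, hk, map_zero]⟩⟩
  refine Set.finite_coe_iff.mp (Finite.of_injective F fun a b hab ↦ ?_)
  have h := congrArg Subtype.val hab
  exact Subtype.ext (Subtype.ext (pointsMapOfEmb_injective E _ h))

end Curve

end Summit.BirchSwinnertonDyer.Rank1Residual.GaloisImage.InertiaDivisible

end
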